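import Mathlib.AlgebraicGeometry.IdealSheaf.Basic
import HarnessLib

/-!
# [OURS · L1 W4.5(b) · EL♮(3) · nose residue, D3-9 support] The reduced ideal of a closed set on an EXPLICIT AFFINE CHART
# `c : Spec R ⟶ P`: `𝓘⟨Z⟩(c(Spec R)) = θ⁻¹(𝔮)` when `c⁻¹Z = V(𝔮)` with `𝔮` radical

Crux chain w45b, child EL♮(3) = stmt-ResolutionOfSingularities-20148; desk table D3, row D3-9 (res-L1-w45b-nose-w3 g2). Generic bookkeeping
used by BOTH charts of the strict-transform line (`…NatVertexLineChartA/ChartB`): it turns the `hI` input of the `DirStepUnobs` producers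
(✓ `dirStepUnobs_univ_of_charts`, ✓ `dirStepUnobs_of_twoCharts`) — «the chosen sections generate the sections of the vanishing ideal sheaf
`𝓘⟨Z⟩` over the chart» — into a statement about an explicit ring `R` and an explicit ideal `𝔮 ⊆ R`.
`--supports stmt-ResolutionOfSingularities-20148 --as helper`. OURS; folklore bookkeeping; AI-written, weaker than expert review.
No `sorry`; standard axioms; DEF-FREE; Mathlib only.

* `mem_vanishingIdeal_ideal_iff` — `f ∈ 𝓘⟨Z⟩(U) ↔ Z ∩ U ⊆ V(f)` for an affine open `U` (Mathlib's `vanishingIdeal_ideal` made pointwise).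
* `preimage_zeroLocus_eq_zeroLocus_chartRingEquiv` — for an open immersion `c : Spec R ⟶ P` and `s ∈ Γ(P, c(Spec R))`:
  `c⁻¹ V(s) = V(θ s)`, `θ = ΓSpecIso ∘ c.appIso ⊤ : Γ(P, c(Spec R)) ≅ R`.
* ★ `vanishingIdeal_ideal_image_eq_comap` — if `c⁻¹Z = V(𝔮)` with `𝔮` radical then `𝓘⟨Z⟩(c(Spec R)) = θ⁻¹𝔮`;
  ★ `span_range_eq_vanishingIdeal_ideal` — hence sections `x_m` with `θ x_m = r_m`, `(r_m) = 𝔮`, GENERATE `𝓘⟨Z⟩(c(Spec R))`.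

References (index only): R. Hartshorne, *Algebraic Geometry* (1977), II Example 3.2.6 / Ex. 2.3 (reduced induced structure) [cite: Hartshorne1977];
The Stacks Project, Tag 01J3 [cite: StacksProject].
-/

set_option linter.dupNamespace false -- mandated namespace `Summit.<Summit>.<Problem>` of this single-conjunct summit

noncomputable section

open CategoryTheory AlgebraicGeometry TopologicalSpace Opposite

namespace Summit.ResolutionOfSingularities.ResolutionOfSingularities.Cruxes.EquisingularLiftNat.Sections

universe u

/-! ## Membership in the sections of a vanishing ideal sheaf -/

/-- **`f ∈ 𝓘⟨Z⟩(U) ↔ Z ∩ U ⊆ V(f)`** for a closed `Z ⊆ X` and an affine open `U` (Mathlib: `𝓘⟨Z⟩(U)` is the vanishing ideal of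
`fromSpec⁻¹ Z ⊆ Spec Γ(X, U)`). [cite: Hartshorne1977, II Example 3.2.6] (folklore) -/
theorem mem_vanishingIdeal_ideal_iff {X : Scheme.{u}} (Z : Closeds X) (U : X.affineOpens) (f : Γ(X, U)) :
    f ∈ (Scheme.IdealSheafData.vanishingIdeal Z).ideal U ↔ (Z : Set X) ∩ (U : X.Opens) ⊆ X.zeroLocus (U := U) {f} := by
  rw [Scheme.IdealSheafData.vanishingIdeal_ideal, ← Ideal.span_singleton_le_iff_mem,
    ← PrimeSpectrum.subset_zeroLocus_iff_le_vanishingIdeal, PrimeSpectrum.zeroLocus_span]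
  constructor
  · intro h x hx
    obtain ⟨y, rfl⟩ : x ∈ Set.range U.2.fromSpec := by rw [IsAffineOpen.range_fromSpec]; exact hx.2
    have hy : y ∈ PrimeSpectrum.zeroLocus ({f} : Set Γ(X, U)) := h hx.1
    rw [← U.2.fromSpec_preimage_zeroLocus] at hy
    exact hy
  · intro h y hy
    rw [← U.2.fromSpec_preimage_zeroLocus]
    exact h ⟨hy, by rw [← IsAffineOpen.range_fromSpec (hU := U.2)]; exact ⟨y, rfl⟩⟩

/-! ## An explicit affine chart `c : Spec R ⟶ P` -/

section Chart

variable {P : Scheme.{u}} {R : CommRingCat.{u}} (c : Spec R ⟶ P) [IsOpenImmersion c]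

/-- The image `c(Spec R)` is an affine open. [folklore] -/
theorem isAffineOpen_image_top : IsAffineOpen (c ''ᵁ ⊤) := by
  rw [Scheme.Hom.image_top_eq_opensRange]
  exact isAffineOpen_opensRange c

/-- **Zero loci through the chart**: `c⁻¹ V(s) = V(θ s)` for `s ∈ Γ(P, c(Spec R))`, `θ = ΓSpecIso ∘ (c.appIso ⊤)`. [folklore] -/
theorem preimage_zeroLocus_eq_zeroLocus (s : Γ(P, c ''ᵁ ⊤)) :
    c ⁻¹' P.zeroLocus (U := c ''ᵁ ⊤) {s} =
      PrimeSpectrum.zeroLocus {(Scheme.ΓSpecIso R).hom ((c.appIso ⊤).hom s)} := by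
  have hb : (Spec R).basicOpen ((c.appIso ⊤).hom s) = c ⁻¹ᵁ P.basicOpen s := by
    rw [Scheme.Hom.appIso_hom', Scheme.Hom.appLE, CommRingCat.comp_apply, Scheme.basicOpen_res, Scheme.preimage_basicOpen,
      top_inf_eq]
  ext x
  have h1 : x ∈ c ⁻¹' P.zeroLocus (U := c ''ᵁ ⊤) {s} ↔ c x ∉ P.basicOpen s := by
    simp only [Set.mem_preimage, Scheme.mem_zeroLocus_iff, Set.mem_singleton_iff, forall_eq]
  have h2 : c x ∈ P.basicOpen s ↔ (Scheme.ΓSpecIso R).hom ((c.appIso ⊤).hom s) ∉ x.asIdeal := by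
    have h3 : x ∈ (Spec R).basicOpen ((c.appIso ⊤).hom s) ↔ c x ∈ P.basicOpen s := by
      rw [hb]; rfl
    rw [← h3, basicOpen_eq_of_affine']
    exact PrimeSpectrum.mem_basicOpen _ _
  rw [h1, h2, not_not]
  change _ ↔ ({(Scheme.ΓSpecIso R).hom ((c.appIso ⊤).hom s)} : Set R) ⊆ (x.asIdeal : Set R)
  rw [Set.singleton_subset_iff, SetLike.mem_coe]

variable (Z : Closeds P) (𝔮 : Ideal R) (h𝔮 : 𝔮.IsRadical) (hZ : c ⁻¹' (Z : Set P) = PrimeSpectrum.zeroLocus (𝔮 : Set R))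

include h𝔮 hZ in
/-- ★ **The reduced ideal of `Z` on the chart**: if `c⁻¹Z = V(𝔮)` with `𝔮` radical, then a section `s` over `c(Spec R)` lies in `𝓘⟨Z⟩` iff
`θ s ∈ 𝔮`. [cite: Hartshorne1977, II Example 3.2.6] (OURS bookkeeping; folklore) -/
theorem mem_vanishingIdeal_ideal_image_iff (s : Γ(P, c ''ᵁ ⊤)) :
    s ∈ (Scheme.IdealSheafData.vanishingIdeal Z).ideal ⟨c ''ᵁ ⊤, isAffineOpen_image_top c⟩ ↔
      (Scheme.ΓSpecIso R).hom ((c.appIso ⊤).hom s) ∈ 𝔮 := by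
  rw [mem_vanishingIdeal_ideal_iff]
  change (Z : Set P) ∩ (c ''ᵁ ⊤ : P.Opens) ⊆ P.zeroLocus {s} ↔ _
  -- both sides of the inclusion live in the image of `c`; pull back along `c`
  have hA : ((c ''ᵁ ⊤ : P.Opens) : Set P) = Set.range c := by
    rw [Scheme.Hom.image_top_eq_opensRange]; rfl
  have key : (Z : Set P) ∩ (c ''ᵁ ⊤ : P.Opens) ⊆ P.zeroLocus {s} ↔ c ⁻¹' (Z : Set P) ⊆ c ⁻¹' P.zeroLocus (U := c ''ᵁ ⊤) {s} := by
    rw [hA]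
    constructor
    · intro h x hx
      exact h ⟨hx, ⟨x, rfl⟩⟩
    · rintro h _ ⟨hy, ⟨x, rfl⟩⟩
      exact h hy
  rw [key, hZ, preimage_zeroLocus_eq_zeroLocus]
  change (PrimeSpectrum.zeroLocus (𝔮 : Set R) : Set (PrimeSpectrum R)) ⊆
      PrimeSpectrum.zeroLocus {(Scheme.ΓSpecIso R).hom ((c.appIso ⊤).hom s)} ↔ _
  rw [← PrimeSpectrum.zeroLocus_span {_}, PrimeSpectrum.zeroLocus_subset_zeroLocus_iff, Ideal.radical_eq_iff.mpr h𝔮,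
    Ideal.span_le, Set.singleton_subset_iff]
  rfl

include h𝔮 hZ in
/-- ★ **`𝓘⟨Z⟩(c(Spec R)) = θ⁻¹(𝔮)`** as ideals. [cite: Hartshorne1977, II Example 3.2.6] (OURS bookkeeping; folklore) -/
theorem vanishingIdeal_ideal_image_eq_comap :
    (Scheme.IdealSheafData.vanishingIdeal Z).ideal ⟨c ''ᵁ ⊤, isAffineOpen_image_top c⟩ =
      𝔮.comap ((c.appIso ⊤ ≪≫ Scheme.ΓSpecIso R).commRingCatIsoToRingEquiv : Γ(P, c ''ᵁ ⊤) →+* R) := by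
  ext s
  rw [mem_vanishingIdeal_ideal_image_iff c Z 𝔮 h𝔮 hZ, Ideal.mem_comap]
  rfl

include h𝔮 hZ in
/-- ★ **Generators through the chart**: sections `x_m ∈ Γ(P, c(Spec R))` whose images `θ x_m = r_m` generate `𝔮` generate
`𝓘⟨Z⟩(c(Spec R))`. [cite: Hartshorne1977, II Example 3.2.6] (OURS bookkeeping; folklore) -/
theorem span_range_eq_vanishingIdeal_ideal {ι : Type*} (r : ι → R) (hr : Ideal.span (Set.range r) = 𝔮)
    (x : ι → Γ(P, c ''ᵁ ⊤)) (hx : ∀ m, (Scheme.ΓSpecIso R).hom ((c.appIso ⊤).hom (x m)) = r m) :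
    Ideal.span (Set.range x) = (Scheme.IdealSheafData.vanishingIdeal Z).ideal ⟨c ''ᵁ ⊤, isAffineOpen_image_top c⟩ := by
  set θ : Γ(P, c ''ᵁ ⊤) ≃+* R := (c.appIso ⊤ ≪≫ Scheme.ΓSpecIso R).commRingCatIsoToRingEquiv with hθ
  have hθx : ∀ m, θ (x m) = r m := hx
  rw [vanishingIdeal_ideal_image_eq_comap c Z 𝔮 h𝔮 hZ, ← hr]
  change _ = Ideal.comap (θ : Γ(P, c ''ᵁ ⊤) →+* R) _
  have hrange : Set.range r = θ '' Set.range x := by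
    ext a
    simp only [Set.mem_range, Set.mem_image, exists_exists_eq_and, hθx]
  rw [hrange, ← Ideal.map_span, Ideal.comap_coe, Ideal.comap_map_of_bijective θ θ.bijective]

end Chart

end Summit.ResolutionOfSingularities.ResolutionOfSingularities.Cruxes.EquisingularLiftNat.Sections

end
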